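import Literature.Probability.LatticeModels.DoubleCurrentsProofs
import Literature.Probability.LatticeModels.GKSInequalities
import HarnessLib

/-!
# ADS15 eq. (2.13): the probability that a sourceless current avoids a finite set of bonds

Trunk G02 (T-STATMECH), topic `Probability/LatticeModels`, namespace `Literature.StatMech`. First step
of the construction of the infinite-volume random currents (ADS15 Thm. 2.3, R1; the named fact
`Literature.Probability.LatticeModels.ads_doubleCurrent_limit_exists` of `DoubleCurrentsInfinite.lean`):

* M. Aizenman, H. Duminil-Copin, V. Sidoravicius, *Random currents and continuity of Ising
  model's spontaneous magnetization*, Comm. Math. Phys. **334** (2015) 719–742, §2.2, proof of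
  Thm. 2.3 (R1), eq. (2.13) (arXiv:1311.1937v3 numbering; bib key
  `AizenmanDuminilCopinSidoraviciusCMP2015`, "ADS15"):
  `P̂^#_{Λ_L,β}[𝒞⁽⁰⁾_E] = ∑_{∂n=∅} w_β(n) 𝟙[n ≡ 0 on E] / ∑_{∂n=∅} w_β(n) = Z^#(Λ_L ∖ E, β)/Z^#(Λ_L, β)`,
  "`Λ_L ∖ E` designates the graph obtained by removing the edges of `E` but keeping all the
  vertices", and (2.14) "the above ratio can be expressed in terms of an expectation value of a
  finite term … `⟨e^{-βK_E}⟩^#_{Λ_L,β}`, `K_E = ∑_{{x,y} ∈ E} J_{x,y} σ_xσ_y`. The convergence of the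
  above expression follows now directly from the convergence of correlation functions as `L`
  tends to infinity."

## Contents

For a finite graph `G` all of whose edges touch the volume `Λ` (the setting of `PlusCurrents.lean`,
which covers both the ghost-free `+` current and — when no edge leaves `Λ` — the free current):

* `plusCurrentSumAvoid G Λ β T A = ∑_{∂n ∩ Λ = A, n ≡ 0 on T} w_β(n)` and its identification with
  the generating sum of the graph with the bonds `T` deleted (`plusCurrentSumAvoid_eq`);
* **(2.13)–(2.14)**: `∑_{∂n∩Λ=∅, n ≡ 0 on T} w / ∑_{∂n∩Λ=∅} w = ⟨exp(-β ∑_{e ∈ T} σ_e)⟩⁺_{Λ;β,0}`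
  (`plusCurrentSumAvoid_div_eq_isingExpect`);
* the box versions for the nearest-neighbour model: `plusCurrentAvoidProb d L β T`,
  `freeCurrentAvoidProb d L β T` (the `P̂⁺_{Λ_L,β}`, `P̂⁰_{Λ_L,β}`-probabilities that the current
  vanishes on the lattice bonds `T`) equal `⟨e^{-βK_T}⟩^{±/0}_{Λ_L;β,0}`
  (`plusCurrentAvoidProb_eq_isingExpect`, `freeCurrentAvoidProb_eq_isingExpect`);
* **convergence as `L → ∞`** (`tendsto_plusCurrentAvoidProb`, `tendsto_freeCurrentAvoidProb`):
  `e^{-βK_T} = cosh(β)^{|T|} ∑_{S ⊆ T} (-tanh β)^{|S|} σ_{A(S)}` is a finite combination of spin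
  products (`expNegBonds_eq_sum`), whose `+`/free box expectations converge by the
  discharged tree facts `hasBoxLimit_isingCorr_plus_holds` / `hasBoxLimit_isingCorr_free_holds`.

## Mathlib status

No random currents in Mathlib. Anchors: `SimpleGraph.deleteEdges`, `SimpleGraph.edgeSet_deleteEdges`,
`Finset.prod_one_add`, `Filter.Tendsto.congr'`, `tendsto_finsetSum`, `Filter.eventually_all_finset`; tree: `plusCurrentSum`,
`isingPartitionFunction_plus_eq` (`PlusCurrents.lean`), `Current.extend`, `Current.tsum_extend_eq`
(`CurrentSwitching.lean`), `isingExpect_plus_map`, `edgesTouching_map` (`TorusZeroMode.lean`),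
`isingExpect_free_map` (`IsingTransport.lean`), `prod_spinProduct_eq_spinProduct_fold`
(`DoubleCurrents.lean`).
-/

noncomputable section

open MeasureTheory Filter Topology Finset Literature.Probability.LatticeModels Literature.Probability.Percolation
open scoped symmDiff

namespace Literature.Probability.LatticeModels

/-! ### Currents avoiding a set of bonds, on a finite graph -/

section General

variable {V : Type*} [Fintype V] [DecidableEq V] (G : SimpleGraph V) [DecidableRel G.Adj]

/-- The generating sum of currents with sources `A` inside `Λ` **vanishing on the bonds of `T`**:
`∑_{∂n ∩ Λ = A, n ≡ 0 on T} w_β(n)` (ADS15 (2.13), numerator with the event `𝒞⁽⁰⁾_T`). [cite: AizenmanDuminilCopinSidoraviciusCMP2015, §2.2, eq. (2.13)] -/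
def plusCurrentSumAvoid (Λ : Finset V) (β : ℝ) (T : Finset (Sym2 V)) (A : Finset V) : ℝ :=
  ∑' n : Current G, if n.sources ∩ Λ = A ∧ (∀ e : G.edgeFinset, (e : Sym2 V) ∈ T → n e = 0) then
    n.weight β else 0

/-- With no bond to avoid this is `plusCurrentSum`. [folklore] -/
theorem plusCurrentSumAvoid_empty (Λ : Finset V) (β : ℝ) (A : Finset V) :
    plusCurrentSumAvoid G Λ β ∅ A = plusCurrentSum G Λ β A := by
  unfold plusCurrentSumAvoid plusCurrentSum
  refine tsum_congr fun n => ?_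
  simp

/-- The summands of `plusCurrentSumAvoid` are summable. [folklore] -/
theorem summable_plusCurrentSumAvoid_term (Λ : Finset V) (β : ℝ) (T : Finset (Sym2 V)) (A : Finset V) :
    Summable fun n : Current G =>
      if n.sources ∩ Λ = A ∧ (∀ e : G.edgeFinset, (e : Sym2 V) ∈ T → n e = 0) then n.weight β else 0 :=
  (Current.summable_weight_abs G β).of_norm_bounded fun n => by
    split_ifs
    · rw [Real.norm_eq_abs, Current.abs_weight]
    · rw [norm_zero]; exact Current.weight_nonneg (abs_nonneg β) n

/-- `plusCurrentSumAvoid ≥ 0` for `β ≥ 0`. [folklore] -/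
theorem plusCurrentSumAvoid_nonneg (Λ : Finset V) {β : ℝ} (hβ : 0 ≤ β) (T : Finset (Sym2 V))
    (A : Finset V) : 0 ≤ plusCurrentSumAvoid G Λ β T A :=
  tsum_nonneg fun n => by
    split_ifs
    · exact Current.weight_nonneg hβ n
    · exact le_rfl

/-- Avoiding more bonds gives a smaller sum (`β ≥ 0`). [folklore] -/
theorem plusCurrentSumAvoid_le_plusCurrentSum (Λ : Finset V) {β : ℝ} (hβ : 0 ≤ β)
    (T : Finset (Sym2 V)) (A : Finset V) :
    plusCurrentSumAvoid G Λ β T A ≤ plusCurrentSum G Λ β A := by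
  refine (summable_plusCurrentSumAvoid_term G Λ β T A).tsum_le_tsum (fun n => ?_)
    (summable_plusCurrentSum_term G Λ β A)
  by_cases h : n.sources ∩ Λ = A
  · by_cases h' : ∀ e : G.edgeFinset, (e : Sym2 V) ∈ T → n e = 0
    · rw [if_pos ⟨h, h'⟩, if_pos h]
    · rw [if_neg (fun hh => h' hh.2), if_pos h]; exact Current.weight_nonneg hβ n
  · rw [if_neg (fun hh => h hh.1), if_neg h]

/-- A current of `G` is supported on `G` with the bonds of `T` deleted iff it vanishes on `T`. [folklore] -/
theorem isSupp_deleteEdges_iff (T : Finset (Sym2 V)) (n : Current G) :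
    Current.IsSupp (G.deleteEdges ↑T) n ↔ ∀ e : G.edgeFinset, (e : Sym2 V) ∈ T → n e = 0 := by
  have key : ∀ e : G.edgeFinset, ((e : Sym2 V) ∉ (G.deleteEdges ↑T).edgeFinset ↔ (e : Sym2 V) ∈ T) := by
    intro e
    rw [SimpleGraph.mem_edgeFinset, SimpleGraph.edgeSet_deleteEdges, Set.mem_sdiff, Finset.mem_coe]
    have he : (e : Sym2 V) ∈ G.edgeSet := SimpleGraph.mem_edgeFinset.1 e.2
    tauto
  unfold Current.IsSupp
  exact ⟨fun h e he => h e ((key e).2 he), fun h e he => h e ((key e).1 he)⟩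

/-- **Currents avoiding `T` are the currents of the graph with `T` deleted** ("`Λ_L ∖ E`
designates the graph obtained by removing the edges of `E` but keeping all the vertices",
ADS15 (2.13)): `∑_{∂n ∩ Λ = A, n ≡ 0 on T} w_β(n) = Z⁺_{G∖T,Λ}(A)`. [cite: AizenmanDuminilCopinSidoraviciusCMP2015, §2.2, eq. (2.13)] -/
theorem plusCurrentSumAvoid_eq (Λ : Finset V) (β : ℝ) (T : Finset (Sym2 V)) (A : Finset V) :
    plusCurrentSumAvoid G Λ β T A = plusCurrentSum (G.deleteEdges ↑T) Λ β A := by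
  have hle : G.deleteEdges ↑T ≤ G := SimpleGraph.deleteEdges_le _
  set f : Current G → ℝ := fun n => if n.sources ∩ Λ = A then n.weight β else 0 with hf
  have h1 : plusCurrentSum (G.deleteEdges ↑T) Λ β A =
      ∑' n₁ : Current (G.deleteEdges ↑T), f (Current.extend n₁) := by
    unfold plusCurrentSum
    refine tsum_congr fun n₁ => ?_
    simp only [hf, Current.sources_extend hle, Current.weight_extend hle]
  rw [h1, Current.tsum_extend_eq hle f]
  unfold plusCurrentSumAvoid
  refine tsum_congr fun n => ?_
  have hiff := isSupp_deleteEdges_iff G T n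
  simp only [hf]
  by_cases hs : Current.IsSupp (G.deleteEdges ↑T) n
  · by_cases hA : n.sources ∩ Λ = A
    · rw [if_pos ⟨hA, hiff.1 hs⟩, if_pos hs, if_pos hA]
    · have h' : ¬(n.sources ∩ Λ = A ∧ ∀ e : G.edgeFinset, (e : Sym2 V) ∈ T → n e = 0) :=
        fun h => hA h.1
      rw [if_neg h', if_pos hs, if_neg hA]
  · have h' : ¬(n.sources ∩ Λ = A ∧ ∀ e : G.edgeFinset, (e : Sym2 V) ∈ T → n e = 0) :=
      fun h => hs (hiff.2 h.2)
    rw [if_neg h', if_neg hs]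

/-- Every edge of `G ∖ T` touches `Λ` if every edge of `G` does. [folklore] -/
theorem edgesTouching_deleteEdges_eq {Λ : Finset V} (hG : edgesTouching G Λ = G.edgeFinset)
    (T : Finset (Sym2 V)) :
    edgesTouching (G.deleteEdges ↑T) Λ = (G.deleteEdges ↑T).edgeFinset := by
  ext e
  rw [mem_edgesTouching_iff, SimpleGraph.mem_edgeFinset]
  constructor
  · exact fun h => h.1
  · intro he
    refine ⟨he, ?_⟩
    have he' : e ∈ G.edgeSet := by
      rw [SimpleGraph.edgeSet_deleteEdges] at he; exact he.1
    have := (mem_edgesTouching_iff (G := G)).1 (hG ▸ SimpleGraph.mem_edgeFinset.2 he')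
    exact this.2

/-- The interaction edges split: `E(G) = E(G ∖ T) ⊔ T` for `T ⊆ E(G)`. [folklore] -/
theorem edgeFinset_eq_deleteEdges_union {T : Finset (Sym2 V)} (hT : T ⊆ G.edgeFinset) :
    G.edgeFinset = (G.deleteEdges ↑T).edgeFinset ∪ T ∧ Disjoint (G.deleteEdges ↑T).edgeFinset T := by
  constructor
  · ext e
    rw [Finset.mem_union, SimpleGraph.mem_edgeFinset, SimpleGraph.mem_edgeFinset,
      SimpleGraph.edgeSet_deleteEdges, Set.mem_sdiff, Finset.mem_coe]
    constructor
    · intro he; by_cases h : e ∈ T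
      · exact Or.inr h
      · exact Or.inl ⟨he, h⟩
    · rintro (⟨he, -⟩ | he)
      · exact he
      · exact SimpleGraph.mem_edgeFinset.1 (hT he)
  · rw [Finset.disjoint_left]
    intro e he heT
    rw [SimpleGraph.mem_edgeFinset, SimpleGraph.edgeSet_deleteEdges, Set.mem_sdiff, Finset.mem_coe] at he
    exact he.2 heT

/-- **Deleting bonds tilts the `+` weight**: for `T ⊆ E(G)` and every edge of `G` touching `Λ`,
`w⁺_{G,Λ}(τ) = w⁺_{G∖T,Λ}(τ) · exp(β ∑_{e ∈ T} σ_e(τ ∨ +))` (the Hamiltonian is a sum over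
`ℰ^b_Λ = E(G) = E(G∖T) ⊔ T`). [cite: AizenmanDuminilCopinSidoraviciusCMP2015, §2.2, eq. (2.14)] -/
theorem isingWeight_plus_eq_deleteEdges_mul {Λ : Finset V} (hG : edgesTouching G Λ = G.edgeFinset)
    {T : Finset (Sym2 V)} (hT : T ⊆ G.edgeFinset) (β : ℝ) (τ : Λ → ℤˣ) :
    isingWeight G Λ β 0 .plus τ = isingWeight (G.deleteEdges ↑T) Λ β 0 .plus τ *
      Real.exp (β * ∑ e ∈ T, bondSpin (glue Λ τ .plus) e) := by
  obtain ⟨hunion, hdisj⟩ := edgeFinset_eq_deleteEdges_union G hT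
  rw [isingWeight, isingWeight, isingHamiltonian, isingHamiltonian,
    show (BoundaryCondition.plus : BoundaryCondition V) = .fixed 1 from rfl, interactionEdges_fixed,
    interactionEdges_fixed, hG, edgesTouching_deleteEdges_eq G hG T, hunion,
    Finset.sum_union hdisj, ← Real.exp_add]
  congr 1
  ring

/-- **ADS15 (2.13)–(2.14), ghost-free form**: if every edge of the finite graph `G` touches `Λ`
and `T ⊆ E(G)`, then for every real `β`,
`∑_{∂n ∩ Λ = ∅, n ≡ 0 on T} w_β(n) / ∑_{∂n ∩ Λ = ∅} w_β(n) = Z⁺_Λ(G∖T)/Z⁺_Λ(G)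
= ⟨exp(-β ∑_{e ∈ T} σ_e)⟩⁺_{Λ;β,0}` — the probability that the sourceless `+` current avoids `T` is
the `+` expectation of `e^{-βK_T}`. [cite: AizenmanDuminilCopinSidoraviciusCMP2015, §2.2, eqs. (2.13)–(2.14)] -/
theorem plusCurrentSumAvoid_div_eq_isingExpect {Λ : Finset V} (hG : edgesTouching G Λ = G.edgeFinset)
    {T : Finset (Sym2 V)} (hT : T ⊆ G.edgeFinset) (β : ℝ) :
    plusCurrentSumAvoid G Λ β T ∅ / plusCurrentSum G Λ β ∅ =
      isingExpect G Λ β 0 .plus (fun σ => Real.exp (-β * ∑ e ∈ T, bondSpin σ e)) := by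
  have hG' := edgesTouching_deleteEdges_eq G hG T
  have hf : Measurable fun σ : SpinConfig V => Real.exp (-β * ∑ e ∈ T, bondSpin σ e) :=
    Real.measurable_exp.comp ((Finset.measurable_sum _ fun e _ => measurable_bondSpin e).const_mul _)
  rw [isingExpect, integral_isingMeasure G Λ β 0 .plus hf, isingPartitionFunction_plus_eq G hG β,
    plusCurrentSumAvoid_eq]
  have hnum : ∑ τ : Λ → ℤˣ, isingWeight G Λ β 0 .plus τ *
      Real.exp (-β * ∑ e ∈ T, bondSpin (glue Λ τ .plus) e) =
      isingPartitionFunction (G.deleteEdges ↑T) Λ β 0 .plus := by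
    unfold isingPartitionFunction
    refine Finset.sum_congr rfl fun τ _ => ?_
    rw [isingWeight_plus_eq_deleteEdges_mul G hG hT β τ, mul_assoc, ← Real.exp_add]
    simp
  rw [hnum, isingPartitionFunction_plus_eq _ hG' β, mul_div_mul_left _ _ (by positivity)]

end General

/-! ### The box currents of the nearest-neighbour model avoiding finitely many lattice bonds -/

variable (d : ℕ)

/-- The Boltzmann factor `e^{-βK_T} = exp(-β ∑_{e ∈ T} σ_e)` of a finite set of bonds
(ADS15 (2.14), `K_E = ∑_{{x,y} ∈ E} J_{x,y} σ_xσ_y`). [cite: AizenmanDuminilCopinSidoraviciusCMP2015, §2.2, eq. (2.14)] -/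
def expNegBonds (β : ℝ) (T : Finset (Sym2 (Site d))) (σ : SpinConfig (Site d)) : ℝ :=
  Real.exp (-β * ∑ e ∈ T, bondSpin σ e)

/-- `e^{-βK_T}` is measurable. [folklore] -/
theorem measurable_expNegBonds (β : ℝ) (T : Finset (Sym2 (Site d))) :
    Measurable (expNegBonds d β T) :=
  Real.measurable_exp.comp ((Finset.measurable_sum _ fun e _ => measurable_bondSpin e).const_mul _)

/-- The lattice bonds of `T`, pulled back to the plus box graph of `Λ_L`. [folklore] -/
def boxBonds (L : ℕ) (T : Finset (Sym2 (Site d))) : Finset (Sym2 (BoxVertex d L)) :=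
  (plusBoxGraph d L).edgeFinset.filter fun e => Sym2.map Subtype.val e ∈ T

/-- **`P̂⁺_{Λ_L,β}[n ≡ 0 on T]`**, the probability that the sourceless `+` current of the box
`Λ_L` (ghost-free form: currents on `plusBoxGraph d L` with no sources in `Λ_L`) vanishes on the
lattice bonds of `T` (ADS15 (2.13) with `𝒞⁽⁰⁾_T`). [cite: AizenmanDuminilCopinSidoraviciusCMP2015, §2.2, eq. (2.13)] -/
def plusCurrentAvoidProb (L : ℕ) (β : ℝ) (T : Finset (Sym2 (Site d))) : ℝ :=
  plusCurrentSumAvoid (plusBoxGraph d L) (boxCore d L) β (boxBonds d L T) ∅ /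
    plusCurrentSum (plusBoxGraph d L) (boxCore d L) β ∅

/-- The lattice bonds of `T`, pulled back to the free box graph of `Λ_L`. [folklore] -/
def freeBoxBonds (L : ℕ) (T : Finset (Sym2 (Site d))) : Finset (Sym2 (BoxVertex d L)) :=
  (freeBoxGraph d L).edgeFinset.filter fun e => Sym2.map Subtype.val e ∈ T

/-- **`P̂⁰_{Λ_L,β}[n ≡ 0 on T]`**, the probability that the sourceless free current of `Λ_L`
vanishes on the lattice bonds of `T` (ADS15 (2.13)). [cite: AizenmanDuminilCopinSidoraviciusCMP2015, §2.2, eq. (2.13)] -/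
def freeCurrentAvoidProb (L : ℕ) (β : ℝ) (T : Finset (Sym2 (Site d))) : ℝ :=
  plusCurrentSumAvoid (freeBoxGraph d L) (boxCore d L) β (freeBoxBonds d L T) ∅ /
    plusCurrentSum (freeBoxGraph d L) (boxCore d L) β ∅

/-- The pulled-back bonds, pushed forward again: on the bonds touching `Λ_L` the map
`e' ↦ e'.map val` is a bijection from `boxBonds` onto `T`. [folklore] -/
theorem sum_boxBonds_eq {L : ℕ} {T : Finset (Sym2 (Site d))}
    (hT : T ⊆ edgesTouching (zdGraph d) (box d L)) (g : Sym2 (Site d) → ℝ) :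
    ∑ e' ∈ boxBonds d L T, g (Sym2.map Subtype.val e') = ∑ e ∈ T, g e := by
  refine Finset.sum_nbij (fun e' => Sym2.map Subtype.val e') (fun e' he' => (Finset.mem_filter.1 he').2)
    (fun a _ b _ h => Sym2.map.injective Subtype.val_injective h) (fun e he => ?_) (fun _ _ => rfl)
  -- surjectivity: an edge touching `Λ_L` is the image of an edge of the plus box graph
  have he' := hT he
  rw [mem_edgesTouching_iff] at he'
  obtain ⟨heG, x, hx, hxe⟩ := he'
  induction e using Sym2.ind with
  | _ a b =>
    have hab : (zdGraph d).Adj a b := (SimpleGraph.mem_edgeSet _).1 heG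
    have ha : a ∈ box d (L + 1) := by
      rcases Sym2.mem_iff.1 hxe with rfl | rfl
      · exact box_subset_box_succ d L hx
      · exact mem_box_succ_of_zdGraph_adj d hx hab.symm
    have hb : b ∈ box d (L + 1) := by
      rcases Sym2.mem_iff.1 hxe with rfl | rfl
      · exact mem_box_succ_of_zdGraph_adj d hx hab
      · exact box_subset_box_succ d L hx
    have hor : a ∈ box d L ∨ b ∈ box d L := by
      rcases Sym2.mem_iff.1 hxe with rfl | rfl
      · exact Or.inl hx
      · exact Or.inr hx
    refine ⟨s((⟨a, ha⟩ : BoxVertex d L), ⟨b, hb⟩), ?_, by simp⟩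
    rw [Finset.mem_coe, boxBonds, Finset.mem_filter, SimpleGraph.mem_edgeFinset, SimpleGraph.mem_edgeSet]
    exact ⟨⟨hab, hor⟩, by simpa using he⟩

/-- Free version of `sum_boxBonds_eq`: bonds inside `Λ_L` pull back to the free box graph. [folklore] -/
theorem sum_freeBoxBonds_eq {L : ℕ} {T : Finset (Sym2 (Site d))}
    (hT : T ⊆ edgesIn (zdGraph d) (box d L)) (g : Sym2 (Site d) → ℝ) :
    ∑ e' ∈ freeBoxBonds d L T, g (Sym2.map Subtype.val e') = ∑ e ∈ T, g e := by
  refine Finset.sum_nbij (fun e' => Sym2.map Subtype.val e') (fun e' he' => (Finset.mem_filter.1 he').2)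
    (fun a _ b _ h => Sym2.map.injective Subtype.val_injective h) (fun e he => ?_) (fun _ _ => rfl)
  have he' := hT he
  rw [mem_edgesIn_iff] at he'
  obtain ⟨heG, hin⟩ := he'
  induction e using Sym2.ind with
  | _ a b =>
    have hab : (zdGraph d).Adj a b := (SimpleGraph.mem_edgeSet _).1 heG
    have ha : a ∈ box d L := hin a (Sym2.mem_mk_left a b)
    have hb : b ∈ box d L := hin b (Sym2.mem_mk_right a b)
    refine ⟨s((⟨a, box_subset_box_succ d L ha⟩ : BoxVertex d L), ⟨b, box_subset_box_succ d L hb⟩),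
      ?_, by simp⟩
    rw [Finset.mem_coe, freeBoxBonds, Finset.mem_filter, SimpleGraph.mem_edgeFinset,
      SimpleGraph.mem_edgeSet]
    exact ⟨⟨hab, ha, hb⟩, by simpa using he⟩

/-- **`P̂⁺_{Λ_L,β}[n ≡ 0 on T] = ⟨e^{-βK_T}⟩⁺_{Λ_L;β,0}`** (ADS15 (2.13)–(2.14), `+` boundary
condition, nearest-neighbour model), for every finite set `T` of bonds touching `Λ_L` and every
real `β`. [cite: AizenmanDuminilCopinSidoraviciusCMP2015, §2.2, eqs. (2.13)–(2.14)] -/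
theorem plusCurrentAvoidProb_eq_isingExpect (L : ℕ) (β : ℝ) {T : Finset (Sym2 (Site d))}
    (hT : T ⊆ edgesTouching (zdGraph d) (box d L)) :
    plusCurrentAvoidProb d L β T = isingExpect (zdGraph d) (box d L) β 0 .plus (expNegBonds d β T) := by
  have hadj : ∀ x ∈ boxCore d L, ∀ y : BoxVertex d L,
      ((zdGraph d).Adj (boxEmb d L x) (boxEmb d L y) ↔ (plusBoxGraph d L).Adj x y) := by
    intro x hx y
    rw [plusBoxGraph_adj, boxEmb_apply, boxEmb_apply]
    exact ⟨fun h => ⟨h, Or.inl ((mem_boxCore d).1 hx)⟩, fun h => h.1⟩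
  have hnb : ∀ x ∈ boxCore d L, ∀ y' : Site d, (zdGraph d).Adj (boxEmb d L x) y' →
      ∃ y : BoxVertex d L, boxEmb d L y = y' := by
    intro x hx y' hxy
    exact ⟨⟨y', mem_box_succ_of_zdGraph_adj d ((mem_boxCore d).1 hx) hxy⟩, rfl⟩
  rw [← map_boxCore d L, isingExpect_plus_map (boxEmb d L) hadj hnb β 0 (measurable_expNegBonds d β T)]
  have hf : (fun σ : SpinConfig (BoxVertex d L) => expNegBonds d β T (SpinConfig.extendAlong (boxEmb d L) σ))
      = fun σ => Real.exp (-β * ∑ e ∈ boxBonds d L T, bondSpin σ e) := by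
    funext σ
    rw [expNegBonds, ← sum_boxBonds_eq d hT]
    congr 2
    refine Finset.sum_congr rfl fun e' _ => ?_
    exact bondSpin_extendAlong_map (boxEmb d L) σ e'
  rw [hf, plusCurrentAvoidProb]
  exact plusCurrentSumAvoid_div_eq_isingExpect _ (edgesTouching_plusBoxGraph d L)
    (Finset.filter_subset _ _) β

/-- **`P̂⁰_{Λ_L,β}[n ≡ 0 on T] = ⟨e^{-βK_T}⟩⁰_{Λ_L;β,0}`** (ADS15 (2.13)–(2.14), free boundary
condition, nearest-neighbour model), for every finite set `T` of bonds inside `Λ_L` and every real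
`β`. [cite: AizenmanDuminilCopinSidoraviciusCMP2015, §2.2, eqs. (2.13)–(2.14)] -/
theorem freeCurrentAvoidProb_eq_isingExpect (L : ℕ) (β : ℝ) {T : Finset (Sym2 (Site d))}
    (hT : T ⊆ edgesIn (zdGraph d) (box d L)) :
    freeCurrentAvoidProb d L β T = isingExpect (zdGraph d) (box d L) β 0 .free (expNegBonds d β T) := by
  have hadj : ∀ x ∈ boxCore d L, ∀ y ∈ boxCore d L,
      ((zdGraph d).Adj (boxEmb d L x) (boxEmb d L y) ↔ (freeBoxGraph d L).Adj x y) := by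
    intro x hx y hy
    rw [freeBoxGraph_adj, boxEmb_apply, boxEmb_apply]
    exact ⟨fun h => ⟨h, (mem_boxCore d).1 hx, (mem_boxCore d).1 hy⟩, fun h => h.1⟩
  rw [← map_boxCore d L, isingExpect_free_map (boxEmb d L) hadj β 0 (measurable_expNegBonds d β T),
    isingExpect_free_eq_plus_of_edgesIn_eq _ (edgesIn_freeBoxGraph d L)]
  have hf : (fun σ : SpinConfig (BoxVertex d L) => expNegBonds d β T (SpinConfig.extendAlong (boxEmb d L) σ))
      = fun σ => Real.exp (-β * ∑ e ∈ freeBoxBonds d L T, bondSpin σ e) := by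
    funext σ
    rw [expNegBonds, ← sum_freeBoxBonds_eq d hT]
    congr 2
    refine Finset.sum_congr rfl fun e' _ => ?_
    exact bondSpin_extendAlong_map (boxEmb d L) σ e'
  rw [hf, freeCurrentAvoidProb]
  exact plusCurrentSumAvoid_div_eq_isingExpect _ (edgesTouching_freeBoxGraph d L)
    (Finset.filter_subset _ _) β

/-- **The double-current pair weight factorises** into the free and the plus sourceless weights:
`w(n₁,n₂) = 𝟙[∂n₁ ∩ Λ_L = ∅] w_β(n₁) · 𝟙[∂n₂ ∩ Λ_L = ∅] w_β(n₂)` (ADS15 (3.1):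
`ℙ_{Λ_L,β} = P⁰_{Λ_L,β} ⊗ P⁺_{Λ_L,β}`; the free current has all its sources in `Λ_L`). [cite: AizenmanDuminilCopinSidoraviciusCMP2015, §3.1, eq. (3.1)] -/
theorem adsPairWeight_eq_mul (L : ℕ) (β : ℝ)
    (p : Current (freeBoxGraph d L) × Current (plusBoxGraph d L)) :
    adsPairWeight d L β p =
      (if p.1.sources ∩ boxCore d L = ∅ then p.1.weight β else 0) *
        (if p.2.sources ∩ boxCore d L = ∅ then p.2.weight β else 0) := by
  rw [adsPairWeight, Finset.inter_eq_left.2 (sources_subset_boxCore d p.1)]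
  have hb : (if p.2.sources ∩ boxCore d L = ∅ then p.2.weight β else 0) =
      if ∀ v ∈ p.2.sources, (v : Site d) ∉ box d L then p.2.weight β else 0 := by
    by_cases h : p.2.sources ∩ boxCore d L = ∅
    · rw [if_pos h, if_pos ((forall_sources_notMem_iff d p.2).2 h)]
    · rw [if_neg h, if_neg fun h' => h ((forall_sources_notMem_iff d p.2).1 h')]
  rw [hb]
  by_cases h1 : p.1.sources = ∅
  · by_cases h2 : ∀ v ∈ p.2.sources, (v : Site d) ∉ box d L
    · rw [if_pos ⟨h1, h2⟩, if_pos h1, if_pos h2]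
    · have h12 : ¬(p.1.sources = ∅ ∧ ∀ v ∈ p.2.sources, (v : Site d) ∉ box d L) := fun h => h2 h.2
      rw [if_neg h12, if_neg h2, mul_zero]
  · have h12 : ¬(p.1.sources = ∅ ∧ ∀ v ∈ p.2.sources, (v : Site d) ∉ box d L) := fun h => h1 h.1
    rw [if_neg h12, if_neg h1, zero_mul]

/-! ### `e^{-βK_T}` as a finite combination of spin products, and the limit `L → ∞` -/

/-- The set of sites `A(S) = Δ_{e ∈ S} {endpoints of e}` with `∏_{e ∈ S} σ_e = σ_{A(S)}`. [folklore] -/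
def bondsSupport (S : Finset (Sym2 (Site d))) : Finset (Site d) :=
  S.fold (fun s t : Finset (Site d) => s ∆ t) ∅ fun e => e.toFinset

/-- **Expansion of the Boltzmann factor** (`e^{-βσ} = cosh β (1 - σ tanh β)` for `σ = ±1`): for a
finite set `T` of bonds with distinct endpoints,
`e^{-βK_T}(σ) = ∑_{S ⊆ T} cosh(β)^{|T|} (-sinh β)^{|S|}/cosh(β)^{|S|} · σ_{A(S)}`. [cite: AizenmanDuminilCopinSidoraviciusCMP2015, §2.2, eq. (2.14)] -/
theorem expNegBonds_eq_sum (β : ℝ) {T : Finset (Sym2 (Site d))} (hT : ∀ e ∈ T, ¬e.IsDiag)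
    (σ : SpinConfig (Site d)) :
    expNegBonds d β T σ = ∑ S ∈ T.powerset,
      Real.cosh β ^ #T * (-Real.sinh β) ^ #S / Real.cosh β ^ #S * spinProduct (bondsSupport d S) σ := by
  classical
  have hcosh : Real.cosh β ≠ 0 := (Real.cosh_pos β).ne'
  have h1 : expNegBonds d β T σ = ∏ e ∈ T, (Real.cosh β + (-Real.sinh β) * spinProduct e.toFinset σ) := by
    rw [expNegBonds, Finset.mul_sum, Real.exp_sum]
    refine Finset.prod_congr rfl fun e he => ?_
    rw [bondSpin_eq_spinProduct_toFinset (hT e he) σ,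
      show -β * spinProduct e.toFinset σ = (-β) * spinProduct e.toFinset σ from rfl,
      Literature.Probability.LatticeModels.exp_mul_eq_cosh_add_sinh_mul (spinProduct_mul_self e.toFinset σ) (-β), Real.cosh_neg,
      Real.sinh_neg]
  have h2 : ∏ e ∈ T, (Real.cosh β + (-Real.sinh β) * spinProduct e.toFinset σ) =
      Real.cosh β ^ #T * ∏ e ∈ T, (1 + (-Real.sinh β) / Real.cosh β * spinProduct e.toFinset σ) := by
    rw [← Finset.prod_const, ← Finset.prod_mul_distrib]
    refine Finset.prod_congr rfl fun e _ => ?_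
    field_simp
  rw [h1, h2, Finset.prod_one_add, Finset.mul_sum]
  refine Finset.sum_congr rfl fun S _ => ?_
  rw [Finset.prod_mul_distrib, Finset.prod_const, Literature.Probability.LatticeModels.prod_spinProduct_eq_spinProduct_fold,
    div_pow, bondsSupport]
  ring

/-- The expectation of `e^{-βK_T}` is the corresponding combination of correlations. [cite: AizenmanDuminilCopinSidoraviciusCMP2015, §2.2, eq. (2.14)] -/
theorem isingExpect_expNegBonds_eq_sum (Λ : Finset (Site d)) (β h : ℝ) (bc : BoundaryCondition (Site d))
    {T : Finset (Sym2 (Site d))} (hT : ∀ e ∈ T, ¬e.IsDiag) :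
    isingExpect (zdGraph d) Λ β h bc (expNegBonds d β T) = ∑ S ∈ T.powerset,
      Real.cosh β ^ #T * (-Real.sinh β) ^ #S / Real.cosh β ^ #S * isingCorr (zdGraph d) Λ β h bc (bondsSupport d S) := by
  have hfun : expNegBonds d β T = fun σ => ∑ S ∈ T.powerset,
      Real.cosh β ^ #T * (-Real.sinh β) ^ #S / Real.cosh β ^ #S * spinProduct (bondsSupport d S) σ :=
    funext (expNegBonds_eq_sum d β hT)
  rw [hfun, isingExpect_finset_sum' _ _ _ _ β _ _ fun S => (measurable_spinProduct _).const_mul _]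
  refine Finset.sum_congr rfl fun S _ => ?_
  rw [isingExpect_const_mul' _ _ _ _ β _ (measurable_spinProduct _)]
  rfl

/-- Lattice bonds have distinct endpoints. [folklore] -/
theorem not_isDiag_of_mem_edgeSet {e : Sym2 (Site d)} (he : e ∈ (zdGraph d).edgeSet) : ¬e.IsDiag :=
  SimpleGraph.not_isDiag_of_mem_edgeSet _ he

/-- A finite set of lattice bonds eventually lies inside the boxes: `T ⊆ ℰ_{Λ_L}` for `L` large. [folklore] -/
theorem eventually_subset_edgesIn {T : Finset (Sym2 (Site d))} (hT : ↑T ⊆ (zdGraph d).edgeSet) :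
    ∀ᶠ L : ℕ in atTop, T ⊆ edgesIn (zdGraph d) (box d L) := by
  have h : ∀ᶠ L : ℕ in atTop, ∀ e ∈ T, e ∈ edgesIn (zdGraph d) (box d L) := by
    rw [Filter.eventually_all_finset]
    intro e he
    have heG := hT he
    induction e using Sym2.ind with
    | _ a b =>
      filter_upwards [eventually_mem_box a, eventually_mem_box b] with L ha hb
      rw [mem_edgesIn_iff]
      refine ⟨heG, fun v hv => ?_⟩
      rcases Sym2.mem_iff.1 hv with rfl | rfl
      · exact ha
      · exact hb
  exact h.mono fun L hL e he => hL e he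

/-- The limit `lim_L P̂⁺_{Λ_L,β}[n ≡ 0 on T] = ∑_{S ⊆ T} cosh(β)^{|T|} (-sinh β)^{|S|}/cosh(β)^{|S|} ⟨σ_{A(S)}⟩⁺_β`
(ADS15 proof of Thm. 2.3, R1, via (2.14) and the plus state). [cite: AizenmanDuminilCopinSidoraviciusCMP2015, Thm. 2.3 (R1), proof] -/
def plusCurrentAvoidLimit (β : ℝ) (T : Finset (Sym2 (Site d))) : ℝ :=
  ∑ S ∈ T.powerset, Real.cosh β ^ #T * (-Real.sinh β) ^ #S / Real.cosh β ^ #S *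
    plusCorr d β 0 (bondsSupport d S)

/-- The limit `lim_L P̂⁰_{Λ_L,β}[n ≡ 0 on T]`, via (2.14) and the free state. [cite: AizenmanDuminilCopinSidoraviciusCMP2015, Thm. 2.3 (R1), proof] -/
def freeCurrentAvoidLimit (β : ℝ) (T : Finset (Sym2 (Site d))) : ℝ :=
  ∑ S ∈ T.powerset, Real.cosh β ^ #T * (-Real.sinh β) ^ #S / Real.cosh β ^ #S *
    freeCorr d β 0 (bondsSupport d S)

/-- **Convergence of `P̂⁺_{Λ_L,β}[n ≡ 0 on T]`** (ADS15 proof of Thm. 2.3, R1: "The convergence of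
the above expression follows now directly from the convergence of correlation functions as `L`
tends to infinity"): for `β ≥ 0` and a finite set `T` of lattice bonds,
`P̂⁺_{Λ_L,β}[n ≡ 0 on T] → ∑_S c_S ⟨σ_{A(S)}⟩⁺_β`, by the existence of the plus state on spin
products (`hasBoxLimit_isingCorr_plus_holds`). [cite: AizenmanDuminilCopinSidoraviciusCMP2015, Thm. 2.3 (R1), proof] -/
theorem tendsto_plusCurrentAvoidProb {β : ℝ} (hβ : 0 ≤ β) {T : Finset (Sym2 (Site d))}
    (hT : ↑T ⊆ (zdGraph d).edgeSet) :
    Tendsto (fun L : ℕ => plusCurrentAvoidProb d L β T) atTop (𝓝 (plusCurrentAvoidLimit d β T)) := by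
  unfold plusCurrentAvoidLimit
  have hdiag : ∀ e ∈ T, ¬e.IsDiag := fun e he => not_isDiag_of_mem_edgeSet d (hT he)
  have hlim : Tendsto (fun L : ℕ => isingExpect (zdGraph d) (box d L) β 0 .plus (expNegBonds d β T)) atTop
      (𝓝 (∑ S ∈ T.powerset, Real.cosh β ^ #T * (-Real.sinh β) ^ #S / Real.cosh β ^ #S *
        plusCorr d β 0 (bondsSupport d S))) := by
    simp_rw [isingExpect_expNegBonds_eq_sum d _ β 0 .plus hdiag]
    exact tendsto_finsetSum _ fun S _ =>
      (hasBoxLimit_isingCorr_plus_holds hβ le_rfl (bondsSupport d S)).const_mul _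
  refine hlim.congr' ?_
  filter_upwards [eventually_subset_edgesIn d hT] with L hL
  exact (plusCurrentAvoidProb_eq_isingExpect d L β (hL.trans (edgesIn_subset_edgesTouching _))).symm

/-- **Convergence of `P̂⁰_{Λ_L,β}[n ≡ 0 on T]`** (ADS15 proof of Thm. 2.3, R1, free boundary
condition), by the existence of the free state on spin products (`hasBoxLimit_isingCorr_free_holds`). [cite: AizenmanDuminilCopinSidoraviciusCMP2015, Thm. 2.3 (R1), proof] -/
theorem tendsto_freeCurrentAvoidProb {β : ℝ} (hβ : 0 ≤ β) {T : Finset (Sym2 (Site d))}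
    (hT : ↑T ⊆ (zdGraph d).edgeSet) :
    Tendsto (fun L : ℕ => freeCurrentAvoidProb d L β T) atTop (𝓝 (freeCurrentAvoidLimit d β T)) := by
  unfold freeCurrentAvoidLimit
  have hdiag : ∀ e ∈ T, ¬e.IsDiag := fun e he => not_isDiag_of_mem_edgeSet d (hT he)
  have hlim : Tendsto (fun L : ℕ => isingExpect (zdGraph d) (box d L) β 0 .free (expNegBonds d β T)) atTop
      (𝓝 (∑ S ∈ T.powerset, Real.cosh β ^ #T * (-Real.sinh β) ^ #S / Real.cosh β ^ #S *
        freeCorr d β 0 (bondsSupport d S))) := by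
    simp_rw [isingExpect_expNegBonds_eq_sum d _ β 0 .free hdiag]
    exact tendsto_finsetSum _ fun S _ =>
      (hasBoxLimit_isingCorr_free_holds hβ le_rfl (bondsSupport d S)).const_mul _
  refine hlim.congr' ?_
  filter_upwards [eventually_subset_edgesIn d hT] with L hL
  exact (freeCurrentAvoidProb_eq_isingExpect d L β hL).symm

end Literature.Probability.LatticeModels
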